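import Summits.Ventures.WeilGRH.KeyMinorantParity
import HarnessLib

/-!
# GRH arm (rh-explicit, venture WeilGRH): THE PRINCIPAL CHARACTER IS THE WORST CHARACTER OF ITS MODULUS — at every window,
  Weil positivity of `χ₀` mod `q` implies Weil positivity of every `χ` mod `q` (and of every `χ` mod `q′ ≥ q`, `rad q ∣ q′`)

Cell `rh-explicit`, WEIL TRACK — GRH ARM (weil-grh-1, gen8; structural companion of `UniformConductorFloorPrincipal.lean`).
Write `U_t(q)` for «every Dirichlet character `χ` mod `q` satisfies `WeilPositivityOnChar χ t`» (Weil's hermitian form of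
`L(s, χ)` non-negative on all smooth tests supported in `[-t, t]`).  The arm's uniform statements (`UniformConductorFloor*`) are
instances of `U_1(q)`; `UniformConductorFloorPrincipal.lean` shows they fail exactly where the PRINCIPAL character `χ₀ = 1` fails.
This file proves that this is no accident:

**THEOREM (`WeilPositivityOnChar.of_principal`).**  For every modulus `q ≠ 1` and every window `t > 0`:
`WeilPositivityOnChar (1 : DirichletCharacter ℂ q) t → ∀ χ mod q, WeilPositivityOnChar χ t`.  Hence
(`forall_weilPositivityOnChar_iff_principal`) **`U_t(q) ↔ WeilPositivityOnChar χ₀ t`**: the all-characters statement of a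
modulus is a statement about ONE explicit real even «character», whose form is the level-`rad q` pseudo-key form with
conductor weight `log q` and no polar term.

**THEOREM (`WeilPositivityOnChar.of_principal_of_dvd`, level raising for `U`).**  If `q ≤ q′` and every prime factor of `q`
divides `q′`, then `WeilPositivityOnChar (1 : DirichletCharacter ℂ q) t → ∀ χ mod q′, WeilPositivityOnChar χ t`; so
`U_t(q) → U_t(q′)` (`forall_weilPositivityOnChar_mono_of_dvd`).  (Both the uniform floor «`q ≥ q₀ ⇒ U`» and the divisibility
floors «`m ∣ q`, `q ≥ q₀(m) ⇒ U`» are upward-closed families of exactly this shape.)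

PROOF (all ingredients are weil-grh-5's key-form kit, `KeyMinorant*.lean`, `KeyWindowDilation.lean`, `KeyParityTransfer.lean`):
(1) Beurling–Deny contraction with a KEY-DEPENDENT majorant (`keyMarkovForm_norm_le_of_key`): for a window function `u` and keys
`v`, `w` with `|v(n)| ≤ Re w(n)`, `Im w(n) = 0`: `keyMarkovForm a L w c |u| ≤ keyMarkovForm a L v c u` — the archimedean jump form
contracts under `u ↦ |u|`, and `Re(v(n)(u⋆ũ)(log n)) ≤ Re w(n)·(|u|⋆|ũ|)(log n)`; with `v = χ` (mod `q′`) and `w = χ₀` (mod `q`):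
`|χ(n)| ≤ 𝟙[(n,q)=1]` because a prime dividing `(n, q)` divides `q′`.  (2) So `Re Q_χ(g) ≥ keyMarkovForm a_χ (log q) χ₀ t |g|`
(`keyMarkovForm_principal_norm_le_re_weilQuadraticChar`).  (3) If the right side were `< 0`: `|g|` is a Lipschitz window function
on `[-t, t]`, so the SAME-WINDOW transfer (`exists_isWeilTest_keyMarkovForm_lt_of_lipschitz`, weil-grh-5 A36) gives a smooth test
`g′` on `[-t, t]` with `keyMarkovForm a_χ (log q) χ₀ t g′ < 0`; (4) parity descent on tests (`E_{0} ≤ E_{1}`, weil-grh-5 A22,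
`weilFinitePrimeQuadraticKey_zero_le_one`): `keyMarkovForm 0 (log q) χ₀ t g′ < 0`, i.e. `Re Q_{χ₀}(g′) < 0`
(`re_weilQuadraticChar_eq_keyMarkovForm`, `charParity χ₀ = 0`) — contradicting the positivity of `χ₀`.

Consequences recorded here: the decision of `U_1(q)` (`UniformConductorFloorOneDecision.lean`) is the decision of ONE real even
form per modulus; the two undecided moduli `18`, `32` are the cells «`χ₀` mod `18` / mod `32` at `t = 1`» (flat-test margins
`+0.016`, `+0.012`: expected TRUE), i.e. single instances of the arm's real-character door
`weilPositivityOnChar_of_twisted_formatC_data` with `ε = (0,0,0,1,1)` / `(0,1,0,1,1)`.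
No definitions; no named facts; RH/GRH-free; standard axioms.

## References

* A. Weil, *Sur les "formules explicites" de la théorie des nombres premiers* (1952), (11) pp. 261–262 and the «lemme»
  p. 262. [Weil1952FormulesExplicites]
* E. Bombieri, *Remarks on Weil's quadratic functional in the theory of prime numbers I*, Rend. Mat. Acc. Lincei (9) 11
  (2000) 183–233, Thm. 2 p. 193 (the increment form). [Bombieri2000Weil]
* A. Beurling, J. Deny, *Dirichlet spaces*, Proc. Nat. Acad. Sci. 45 (1959) 208–215 (the contraction `u ↦ |u|`). [folklore]

Re-landed with every declaration byte-identical (this docstring line only) to re-trigger the hub build of this module's olean —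
accepted 2026-08-24T17:2xZ (p383381), still unbuilt at 01:35Z while later WeilGRH modules built (lead R14-3 append remedy); weil-grh-1 gen8.
-/

set_option autoImplicit false

noncomputable section

open Set MeasureTheory Filter

namespace Summit.Ventures.WeilGRH

open Literature.NumberTheory.LFunctions
open Summit.RiemannHypothesis.RiemannHypothesis.Theorems.WeilFormatC
open scoped ArithmeticFunction.vonMangoldt

namespace UniformFloor

variable {q q' : ℕ} {b : ℝ} {u : ℝ → ℂ}

/-! ## The contraction with a key-dependent majorant -/

/-- **Beurling–Deny contraction, key by key.**  For a window function `u` on `[-b, b]` (`b ≥ 0`), a parity `a`, a level `L`,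
a window parameter `c`, and two prime-power data `v`, `w` with `|v(n)| ≤ Re w(n)` and `w(n)` real:
`keyMarkovForm a L w c |u| ≤ keyMarkovForm a L v c u`.  (weil-grh-5's `keyMarkovForm_norm_le` is the case `w = 1`.)
[cite: Bombieri2000Weil, Thm 2 (p. 193)] -/
theorem keyMarkovForm_norm_le_of_key (hb : 0 ≤ b) (hu : IsWindowFunction b u) (a : ℕ) (L : ℝ) {v w : ℕ → ℂ}
    (hvw : ∀ n, ‖v n‖ ≤ (w n).re) (hw : ∀ n, (w n).im = 0) (c : ℝ) :
    keyMarkovForm a L w c (fun x ↦ ((‖u x‖ : ℝ) : ℂ)) ≤ keyMarkovForm a L v c u := by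
  have hn := isWindowFunction_norm hu
  rw [keyMarkovForm_eq_reduced_of_isWindowFunction hn a L w c, keyMarkovForm_eq_reduced_of_isWindowFunction hu a L v c,
    integral_norm_sq_norm]
  have harch : (∫ t in Ioi (0 : ℝ), weilArchDensityPar a t * weilIncrement (fun x ↦ ((‖u x‖ : ℝ) : ℂ)) t) ≤
      ∫ t in Ioi (0 : ℝ), weilArchDensityPar a t * weilIncrement u t := by
    refine integral_mono_of_nonneg ?_ (integrableOn_arch_of_isWindowFunction hb hu a) ?_
    · refine (ae_restrict_iff' measurableSet_Ioi).2 (Eventually.of_forall fun t ht ↦ ?_)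
      exact mul_nonneg (weilArchDensityPar_nonneg_le a ht).1 (weilIncrement_nonneg _ _)
    · refine (ae_restrict_iff' measurableSet_Ioi).2 (Eventually.of_forall fun t ht ↦ ?_)
      exact mul_le_mul_of_nonneg_left (weilIncrement_norm_le hu t) (weilArchDensityPar_nonneg_le a ht).1
  have hprime : ∑ n ∈ weilPrimeIndex c, (Λ n : ℝ) / Real.sqrt n *
        (2 * (v n * weilConv u (weilReflect u) (Real.log n)).re) ≤
      ∑ n ∈ weilPrimeIndex c, (Λ n : ℝ) / Real.sqrt n *
        (2 * (w n * weilConv (fun x ↦ ((‖u x‖ : ℝ) : ℂ)) (weilReflect fun x ↦ ((‖u x‖ : ℝ) : ℂ))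
          (Real.log n)).re) := by
    refine Finset.sum_le_sum fun n _ ↦
      mul_le_mul_of_nonneg_left ?_ (div_nonneg ArithmeticFunction.vonMangoldt_nonneg (Real.sqrt_nonneg _))
    refine mul_le_mul_of_nonneg_left ?_ zero_le_two
    have hk := norm_weilConv_weilReflect_le_norm u (Real.log n)
    have hre : (w n * weilConv (fun x ↦ ((‖u x‖ : ℝ) : ℂ)) (weilReflect fun x ↦ ((‖u x‖ : ℝ) : ℂ)) (Real.log n)).re =
        (w n).re * (weilConv (fun x ↦ ((‖u x‖ : ℝ) : ℂ)) (weilReflect fun x ↦ ((‖u x‖ : ℝ) : ℂ)) (Real.log n)).re := by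
      rw [Complex.mul_re, hw n, zero_mul, sub_zero]
    rw [hre]
    calc (v n * weilConv u (weilReflect u) (Real.log n)).re
        ≤ ‖v n * weilConv u (weilReflect u) (Real.log n)‖ := Complex.re_le_norm _
      _ = ‖v n‖ * ‖weilConv u (weilReflect u) (Real.log n)‖ := norm_mul _ _
      _ ≤ (w n).re * (weilConv (fun x ↦ ((‖u x‖ : ℝ) : ℂ)) (weilReflect fun x ↦ ((‖u x‖ : ℝ) : ℂ)) (Real.log n)).re :=
          mul_le_mul (hvw n) hk (norm_nonneg _) ((norm_nonneg _).trans (hvw n))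
  linarith

/-! ## The principal key of a divisor-closed smaller modulus minorises every character -/

/-- The values of the principal character are real. [folklore] -/
theorem one_apply_im (x : ZMod q) : ((1 : DirichletCharacter ℂ q) x).im = 0 := by
  by_cases hx : IsUnit x
  · rw [MulChar.one_apply hx, Complex.one_im]
  · rw [MulChar.map_nonunit _ hx, Complex.zero_im]

/-- **`|χ(n)| ≤ χ₀⁽ᵠ⁾(n)`** for `χ` mod `q′` and the principal character mod `q`, when every prime factor of `q` divides `q′`:
at `n` prime to `q` the right side is `1 ≥ |χ(n)|`; otherwise a prime `p ∣ (n, q)` divides `q′`, so `χ(n) = 0`. [folklore] -/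
theorem norm_apply_le_re_one_apply (hrad : ∀ p : ℕ, p.Prime → p ∣ q → p ∣ q') (χ : DirichletCharacter ℂ q') (n : ℕ) :
    ‖χ (n : ZMod q')‖ ≤ ((1 : DirichletCharacter ℂ q) (n : ZMod q)).re := by
  by_cases hn : n.Coprime q
  · rw [MulChar.one_apply ((ZMod.isUnit_iff_coprime n q).2 hn), Complex.one_re]
    exact χ.norm_le_one _
  · rw [MulChar.map_nonunit _ (fun h ↦ hn ((ZMod.isUnit_iff_coprime n q).1 h)), Complex.zero_re]
    have hp := Nat.Prime.not_coprime_iff_dvd.1 hn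
    obtain ⟨p, hp, hpn, hpq⟩ := hp
    have hnq' : ¬ n.Coprime q' := Nat.Prime.not_coprime_iff_dvd.2 ⟨p, hp, hpn, hrad p hp hpq⟩
    rw [MulChar.map_nonunit _ (fun h ↦ hnq' ((ZMod.isUnit_iff_coprime n q').1 h)), norm_zero]

/-- **The principal-key minorant.**  For `χ` mod `q′ ≠ 1`, a test function `g` on `[-t, t]` (`t ≥ 0`), and a modulus `q ≤ q′`
whose prime factors divide `q′`: `keyMarkovForm a_χ (log q) χ₀⁽ᵠ⁾ t |g| ≤ Re Q_χ(g)`.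
[cite: Weil1952FormulesExplicites, (11) pp. 261–262; Bombieri2000Weil, Thm 2 (p. 193)] -/
theorem keyMarkovForm_principal_norm_le_re_weilQuadraticChar (hq' : q' ≠ 1) (hqq : q ≤ q')
    (hrad : ∀ p : ℕ, p.Prime → p ∣ q → p ∣ q') (χ : DirichletCharacter ℂ q') {g : ℝ → ℂ} (hg : IsWeilTest g) {t : ℝ}
    (ht : 0 ≤ t) (hsupp : tsupport g ⊆ Icc (-t) t) :
    keyMarkovForm (charParity χ) (Real.log q) (fun n ↦ (1 : DirichletCharacter ℂ q) (n : ZMod q)) t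
        (fun x ↦ ((‖g x‖ : ℝ) : ℂ)) ≤ (weilQuadraticChar χ g).re := by
  rw [re_weilQuadraticChar_eq_keyMarkovForm hq' χ hg hsupp]
  have h1 := keyMarkovForm_norm_le_of_key ht (isWindowFunction_of_isWeilTest hg hsupp) (charParity χ) (Real.log q')
    (v := fun n ↦ χ (n : ZMod q')) (w := fun n ↦ (1 : DirichletCharacter ℂ q) (n : ZMod q))
    (fun n ↦ norm_apply_le_re_one_apply hrad χ n) (fun n ↦ one_apply_im _) t
  have hL : Real.log q ≤ Real.log q' := by
    rcases Nat.eq_zero_or_pos q with h0 | hpos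
    · rw [h0, Nat.cast_zero, Real.log_zero]
      exact Real.log_natCast_nonneg q'
    · exact Real.log_le_log (by exact_mod_cast hpos) (by exact_mod_cast hqq)
  rw [keyMarkovForm_eq_add_norm (charParity χ) (Real.log q) (Real.log q')
    (fun n ↦ (1 : DirichletCharacter ℂ q) (n : ZMod q)) t] at h1
  have h2 : 0 ≤ (Real.log q' - Real.log q) * ∫ x : ℝ, ‖(((‖g x‖ : ℝ) : ℂ))‖ ^ 2 :=
    mul_nonneg (by linarith) (integral_nonneg fun x ↦ sq_nonneg _)
  linarith

/-! ## The theorems -/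

/-- ★★★ **LEVEL RAISING FOR THE ALL-CHARACTERS STATEMENT.**  `q ≠ 1`, `q ≤ q′`, every prime factor of `q` divides `q′`,
`t > 0`: if the PRINCIPAL character mod `q` is Weil-positive on `[-t, t]`, then EVERY Dirichlet character mod `q′` (any parity,
any values, any conductor) is. [cite: Weil1952FormulesExplicites, (11) pp. 261–262 and the «lemme» p. 262] -/
theorem WeilPositivityOnChar.of_principal_of_dvd (hq : q ≠ 1) (hqq : q ≤ q') (hrad : ∀ p : ℕ, p.Prime → p ∣ q → p ∣ q')
    {t : ℝ} (ht : 0 < t) (h1 : WeilPositivityOnChar (1 : DirichletCharacter ℂ q) t) (χ : DirichletCharacter ℂ q') :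
    WeilPositivityOnChar χ t := by
  have hq' : q' ≠ 1 := by
    rintro rfl
    have hq0 : q = 0 := by omega
    have h2 : (2 : ℕ) ∣ 1 := hrad 2 Nat.prime_two (hq0 ▸ dvd_zero 2)
    omega
  intro g hg hsupp
  refine le_trans ?_ (keyMarkovForm_principal_norm_le_re_weilQuadraticChar hq' hqq hrad χ hg ht.le hsupp)
  by_contra hneg
  set v₀ : ℕ → ℂ := fun n ↦ (1 : DirichletCharacter ℂ q) (n : ZMod q) with hv₀
  obtain ⟨K, hK⟩ := exists_lipschitz_norm_of_isWeilTest hg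
  have hlt : keyMarkovForm (charParity χ) (Real.log q) v₀ t (fun x ↦ ((‖g x‖ : ℝ) : ℂ)) <
      0 * ∫ x, ‖(((‖g x‖ : ℝ) : ℂ))‖ ^ 2 := by
    rw [zero_mul]
    exact not_le.1 hneg
  obtain ⟨g', hg', hsupp', hlt'⟩ := exists_isWeilTest_keyMarkovForm_lt_of_lipschitz ht
    (isWindowFunction_norm (isWindowFunction_of_isWeilTest hg hsupp)) hK (charParity χ) (Real.log q) v₀ hlt
  rw [zero_mul] at hlt'
  -- parity descent on the test function `g'`
  have hpar : keyMarkovForm 0 (Real.log q) v₀ t g' ≤ keyMarkovForm (charParity χ) (Real.log q) v₀ t g' := by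
    have hN : Real.exp (2 * t) ≤ ((⌈Real.exp (2 * t)⌉₊ : ℕ) : ℝ) + 1 := (Nat.le_ceil _).trans (by linarith)
    rcases Nat.le_one_iff_eq_zero_or_eq_one.1 (charParity_le_one χ) with h0 | h1'
    · rw [h0]
    · rw [h1', keyMarkovForm_eq_weilFinitePrimeQuadraticKey hg' hsupp' hN zero_le_one,
        keyMarkovForm_eq_weilFinitePrimeQuadraticKey hg' hsupp' hN le_rfl]
      exact weilFinitePrimeQuadraticKey_zero_le_one hg' _ _ _
  -- positivity of the principal character at `g'`
  have hpos : 0 ≤ keyMarkovForm 0 (Real.log q) v₀ t g' := by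
    have hev : charParity (1 : DirichletCharacter ℂ q) = 0 :=
      charParity_of_even (show (1 : DirichletCharacter ℂ q) (-1) = 1 from MulChar.one_apply isUnit_one.neg)
    have h := h1 g' hg' hsupp'
    rwa [re_weilQuadraticChar_eq_keyMarkovForm hq 1 hg' hsupp', hev] at h
  linarith

/-- ★★★ **THE PRINCIPAL CHARACTER IS THE WORST CHARACTER OF ITS MODULUS.**  For `q ≠ 1` and `t > 0`: Weil positivity on
`[-t, t]` of the principal character mod `q` implies Weil positivity on `[-t, t]` of EVERY Dirichlet character mod `q`.
[cite: Weil1952FormulesExplicites, (11) pp. 261–262 and the «lemme» p. 262] -/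
theorem WeilPositivityOnChar.of_principal (hq : q ≠ 1) {t : ℝ} (ht : 0 < t)
    (h1 : WeilPositivityOnChar (1 : DirichletCharacter ℂ q) t) (χ : DirichletCharacter ℂ q) : WeilPositivityOnChar χ t :=
  WeilPositivityOnChar.of_principal_of_dvd hq le_rfl (fun _ _ h ↦ h) ht h1 χ

/-- ★★ **`U_t(q) ↔` positivity of the principal character**: «every character mod `q` is Weil-positive on `[-t, t]`» is
equivalent to the single statement for `χ₀ = 1` (`q ≠ 1`, `t > 0`). [cite: Weil1952FormulesExplicites, (11) pp. 261–262] -/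
theorem forall_weilPositivityOnChar_iff_principal (hq : q ≠ 1) {t : ℝ} (ht : 0 < t) :
    (∀ χ : DirichletCharacter ℂ q, WeilPositivityOnChar χ t) ↔ WeilPositivityOnChar (1 : DirichletCharacter ℂ q) t :=
  ⟨fun h ↦ h 1, fun h χ ↦ WeilPositivityOnChar.of_principal hq ht h χ⟩

/-- ★★ **`U_t` is upward closed along divisibility of radicals**: if every character mod `q` is Weil-positive on `[-t, t]`
(`q ≠ 1`, `t > 0`), then so is every character mod `q′` for every `q′ ≥ q` divisible by each prime factor of `q` — in
particular for every multiple `q′` of `q`. [cite: Weil1952FormulesExplicites, (11) pp. 261–262] -/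
theorem forall_weilPositivityOnChar_mono_of_dvd (hq : q ≠ 1) (hqq : q ≤ q')
    (hrad : ∀ p : ℕ, p.Prime → p ∣ q → p ∣ q') {t : ℝ} (ht : 0 < t)
    (h : ∀ χ : DirichletCharacter ℂ q, WeilPositivityOnChar χ t) (χ : DirichletCharacter ℂ q') :
    WeilPositivityOnChar χ t :=
  WeilPositivityOnChar.of_principal_of_dvd hq hqq hrad ht (h 1) χ

/-- The multiples case: `U_t(q) → U_t(k·q)` for `k ≥ 1`. [cite: Weil1952FormulesExplicites, (11) pp. 261–262] -/
theorem forall_weilPositivityOnChar_mul (hq : q ≠ 1) {k : ℕ} (hk : k ≠ 0) {t : ℝ} (ht : 0 < t)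
    (h : ∀ χ : DirichletCharacter ℂ q, WeilPositivityOnChar χ t) (χ : DirichletCharacter ℂ (k * q)) :
    WeilPositivityOnChar χ t :=
  forall_weilPositivityOnChar_mono_of_dvd hq (Nat.le_mul_of_pos_left q (Nat.pos_of_ne_zero hk))
    (fun _ _ h ↦ h.mul_left k) ht h χ

end UniformFloor

end Summit.Ventures.WeilGRH

end
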